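import Literature.NumberTheory.Automorphic.CDTTheorem722
import Literature.NumberTheory.EllipticCurves.EichlerShimuraConstruction
import Literature.NumberTheory.EllipticCurves.IsogenyFaltingsLFunctionProofs
import Literature.NumberTheory.EllipticCurves.ComplexMultiplicationLFunctionIsogenyHoldsProofs
import Literature.NumberTheory.EllipticCurves.NewformsMultiplicityOneProofs
import Literature.NumberTheory.EllipticCurves.NewformsMainLemmaProofs
import Literature.NumberTheory.EllipticCurves.NewformsCoeffFieldHolds
import Literature.NumberTheory.EllipticCurves.DeligneSerreProp27Proofs
import HarnessLib

/-!
# CDT Theorem 7.2.2, proofs file: BCDT's "(3) ⇒ (2)" from the catalogued classical facts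

Sibling proofs file (theorems only: no definitions, no named facts, no `sorry`) of
`Literature.NumberTheory.Automorphic.CDTTheorem722`, which decomposes the named fact
`Literature.NumberTheory.Automorphic.BCDT.CDT_theorem_7_2_2` (Conrad–Diamond–Taylor 1999, Thm. 7.2.2:
*"Let `E/ℚ` be an elliptic curve such that `ρ̄_{E,5}|_{ℚ(√5)}` is absolutely irreducible. If
`ρ̄_{E,5}` is modular, then `E` is modular"*) into its two printed inputs, carried there as
explicit hypotheses: the `5`-adic modularity lifting statement `hlift` of pp. 553–554 of CDT, and
`h32`, Breuil–Conrad–Diamond–Taylor's implication **(3) ⇒ (2)** (J. Amer. Math. Soc. 14 (2001),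
Introduction, p. 845: *"(2) `L(E, s) = L(f, s)` for some eigenform `f` of weight `2` and level
`N(E)`. (3) For some prime `ℓ`, the representation `ρ_{E,ℓ}` is modular. … The implication
(3) ⇒ (2) follows from a theorem of Carayol [Ca1] and a theorem of Faltings [Fa2]."*).

This file **proves (3) ⇒ (2)** — for every prime `ℓ` — from four results that the tree already
carries as catalogued named facts, so that inside the tree `CDT_theorem_7_2_2` becomes equivalent to
its `5`-adic lifting statement granted classical facts only
(`CDT_theorem_7_2_2_iff_lift_of_facts`):

* `DeligneSerre1974_span_integralLattice1 N 2` for all `N` (Deligne–Serre 1974, (2.7.2) in weight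
  `2` = Shimura 1971, Thm. 3.52: `S₂(Γ₁(N))` is spanned by forms with integral twisted
  `q`-expansions) — the rational structure behind the conjugates `σ(f)` of an eigenform
  (Deligne–Serre (2.7.4));
* `eichlerShimuraConstruction` (Knapp 1993, Thm. 11.74 with Thm. 12.8): a newform
  `f ∈ S₂(Γ₀(N))` with integer coefficients has an elliptic curve `E_f/ℚ` with `aₙ(E_f) = aₙ(f)`;
* `WeierstrassCurve.isIsogenous_iff_frobeniusTrace_eq` (Faltings 1983, §5 Kor. 2): curves with
  `a_p` equal for almost all `p` are `ℚ`-isogenous;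
* `IsNewformOf.level_eq_conductorNorm` (Carayol 1986; Diamond–Shurman Thm. 8.8.1): the level of the
  newform of `E` is `N_E`.

## The argument (`isModular_of_isModularGaloisRepTate_of_facts`)

Let `ρ_{E,ℓ}` be modular (`W.IsModularGaloisRepTate ℓ`, `CDTTheorem722`): there is a newform
`f ∈ S_k(Γ₁(N))` and `ι : K_f ↪ K ⊇ ℚ_ℓ` with `char(Frob_p | T_ℓ E) = ι(X² - a_p(f) X + ε(p)p^{k-1})`
for `p ∤ N ℓ`; by `isModularGaloisRepTate_iff_weight_two` (loc. cit.) `k = 2` and `ε = 1`.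

1. (Part 5) `f` is fixed by the diamond operators, so it is the lift of a newform `f₀ ∈ S₂(Γ₀(N))`
   (Diamond–Shurman §4.3; tree: `exists_liftToGamma1_eq_of_forall_diamondOp_eq`,
   `isNewform1_liftToGamma1_iff_holds`), and comparing `X`-coefficients at a good prime `p ∤ N ℓ`
   gives `a_p(f₀) = tr(Frob_p | T_ℓ E) = a_p(E) ∈ ℤ` (Silverman *AEC* C.21.3; tree:
   `trace_galoisRepTate_frobenius_of_hasGoodReductionAt_holds`) for all `p ∤ N ℓ N_E`.
2. (Parts 1, 3, 4) **All** `a_p(f₀)` are integers.  Strong multiplicity one on `Γ₀(N)` with a finite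
   exceptional set of primes and an arbitrary competitor (Atkin–Lehner 1970, Thm. 4 with Lemma 26;
   Part 1, `IsNewform0.eq_smul_of_heckeT_eq_smul_off`, the auxiliary-modulus form of the tree's
   `NewformsMultiplicityOneProofs`) and Deligne–Serre's conjugation (2.7.4) (Part 4, via
   `LatticeEigen.exists_eigenvector_conj` in the integral basis furnished by (2.7.2)) show that every
   embedding `φ : ℚ(a_p(f₀) : p) → ℂ` fixes every `a_p(f₀)`; such elements are rational (Part 3,
   `exists_ratCast_eq_of_forall_algHom_adjoin_apply_eq`), and the `a_p(f₀)` are algebraic integers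
   (Shimura Thm. 3.48; tree: `IsNewform0.isIntegral_coeff_holds`).
3. (Part 2) Hence all `aₙ(f₀) ∈ ℤ`, by the Hecke recursions `a_{pm} = a_p a_m - 𝟙_N(p) p a_{m/p}`
   (Diamond–Shurman Prop. 5.8.5; `IsNewform0.exists_int_eq_cuspCoeff`).
4. (Part 6) The Eichler–Shimura curve `E_f` has `a_p(E_f) = a_p(f₀) = a_p(E)` off `N ℓ N_E`, so
   `E ~ E_f` by Faltings (tree: `WeierstrassCurve.isIsogenous_of_finite_setOf_LFunction_ne`), whence
   `L(E, s) = L(E_f, s) = L(f₀, s)` (isogeny invariance, a THEOREM of the tree: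
   `WeierstrassCurve.IsIsogenous.LFunction_eq`), i.e. `f₀` is the newform of `E`, and `N = N_E` by
   Carayol: `E` is modular (`IsModular`, BCDT's condition (2)).

Consequences: `three_imp_two_of_facts` (the hypothesis `h32` of `CDTTheorem722` at `ℓ = 5`),
`isModular_iff_isModularGaloisRepTate_of_facts` (conditions (2)–(4) agree),
`CDT_theorem_7_2_2_of_lift_of_facts` and `CDT_theorem_7_2_2_iff_lift_of_facts`: **granted the four
classical facts, the named fact `CDT_theorem_7_2_2` is equivalent to the `5`-adic modularity lifting
statement of CDT pp. 553–554** (Thm. 7.1.1 = Thm. 5.4.2 (`R = T`) with Diamond 1996, Thm. 5.3;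
Lemma 7.1.3; §2.2; §B.2, Prop. B.4.2; Conrad 1999, Thm. 5.3), which is the part of Theorem 7.2.2
that needs the `p`-adic Hodge theory and deformation theory absent from Mathlib.

## References

* [ConradDiamondTaylor1999] B. Conrad, F. Diamond, R. Taylor, *Modularity of certain potentially
  Barsotti–Tate Galois representations*, J. Amer. Math. Soc. 12 (1999), Thm. 7.2.2 and its proof
  (pp. 553–554).
* [BCDTJAMS2001] C. Breuil, B. Conrad, F. Diamond, R. Taylor, J. Amer. Math. Soc. 14 (2001),
  Introduction, p. 845: conditions (1)–(4), "(3) ⇒ (2) follows from a theorem of Carayol [Ca1] and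
  a theorem of Faltings [Fa2]".
* [AtkinLehner1970] A. O. L. Atkin, J. Lehner, *Hecke operators on `Γ₀(m)`*, Math. Ann. 185 (1970):
  Thm. 3, Thm. 4 with Lemma 26, Thm. 5.
* [DeligneSerreASENS1974] P. Deligne, J.-P. Serre, *Formes modulaires de poids 1*, Ann. Sci. ÉNS 7
  (1974): Prop. 2.7, (2.7.2)–(2.7.4).
* [DiamondShurman2005] F. Diamond, J. Shurman, *A First Course in Modular Forms*: §4.3, §5.2,
  Prop. 5.8.5, Thm. 5.8.2, Thm. 6.5.1, Thm. 8.8.1, Thm. 9.4.1.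
* [Knapp1993] A. W. Knapp, *Elliptic Curves*: Thm. 9.22, Thm. 9.27, Thm. 11.67, Thm. 11.74,
  Thm. 12.8.
* [Faltings1983Endlichkeit] G. Faltings, Invent. Math. 73 (1983), §5 Korollar 2.
* [SilvermanAEC2009] J. H. Silverman, *The Arithmetic of Elliptic Curves*, C.21 Remark 21.3.

## Design

Theorems only; `noncomputable section`.  Parts 1, 2 and 4 live in
`namespace Literature.NumberTheory.EllipticCurves.ModularForms` next to the theory they extend
(`NewformsMultiplicityOneProofs`, `NewformsHeckeProofs`, `DeligneSerreProp27Proofs`), Parts 3, 5, 6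
in `namespace Literature.NumberTheory.Automorphic.BCDT`.  The four deep inputs are hypotheses naming
existing facts of the tree (no new named fact is introduced).  Axioms of every theorem: `propext`,
`Classical.choice`, `Quot.sound`.
-/

noncomputable section

open scoped MatrixGroups ModularForm

open CongruenceSubgroup UpperHalfPlane

/-! ## Part 1. Strong multiplicity one on `Γ₀(N)` off finitely many primes -/

namespace Literature.NumberTheory.EllipticCurves.ModularForms

section OffPrimes

variable {N : ℕ} [NeZero N] {k : ℤ} {f : CuspForm (Gamma0 N) k} {a : ℕ → ℂ} {R : ℕ} [NeZero R]

/-- **A nonzero new `T_p`-eigenform (`p ∤ N R`) has `a₁ ≠ 0`**, the auxiliary-modulus form of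
`coeff_one_ne_zero_of_mem_newSubspace0`: if `f ≠ 0` is new of level `N` and `T_p f = λ_p f` for all
primes `p ∤ N R`, then `a₁(f) ≠ 0` — otherwise the coefficients prime to `N R` vanish (Hecke
recursion, `coeff_eq_zero_of_coprime_of_forall_heckeT_eq_smul_of_dvd`), so `f` is old (Main Lemma
with the auxiliary modulus `N R`, `mem_oldSubspace0_of_coeff_eq_zero_of_coprime`; cf. Miyake
Thm. 4.6.8), contradicting `old ∩ new = 0`. [cite: Knapp1993, Thm. 9.27 (§IX.7)] -/
theorem coeff_one_ne_zero_of_mem_newSubspace0_off (hf0 : f ≠ 0) (hfnew : f ∈ newSubspace0 N k)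
    (hfT : ∀ (p : ℕ) (hp : p.Prime), ¬ p ∣ N * R →
      (haveI : NeZero p := ⟨hp.ne_zero⟩; heckeT (Gamma0 N) k p f) = a p • f) :
    (qExpansion 1 ⇑f).coeff 1 ≠ 0 := by
  intro h1
  haveI : NeZero (N * R) := ⟨mul_ne_zero (NeZero.ne N) (NeZero.ne R)⟩
  have hold : f ∈ oldSubspace0 N k := mem_oldSubspace0_of_coeff_eq_zero_of_coprime f
    (coeff_eq_zero_of_coprime_of_forall_heckeT_eq_smul_of_dvd (dvd_mul_right N R) f a hfT h1)
  exact hf0 ((Submodule.disjoint_def.mp (disjoint_oldSubspace0_newSubspace0_holds N k)) f hold hfnew)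

/-- **An eigenform at a lower level equivalent, off `N R`, to a new eigenform has `a₁ = 0`**
(auxiliary-modulus form of `coeff_one_eq_zero_of_equiv`): `f ≠ 0` new of level `N` with
`T_p f = λ_p f` for `p ∤ N R`, `M` a proper divisor of `N`, `h ∈ S_k(Γ₀(M))` with `T_p h = λ_p h`
for `p ∤ N R`; then `a₁(h) = 0`, by the argument of Diamond–Shurman, proof of Thm. 5.8.2, run
with the oldform `ι₁ h` and the sieve modulus `N R`. [cite: Knapp1993, Thm. 9.22 (§IX.7, p. 283)] -/
theorem coeff_one_eq_zero_of_equiv_off (hf0 : f ≠ 0) (hfnew : f ∈ newSubspace0 N k)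
    (hfT : ∀ (p : ℕ) (hp : p.Prime), ¬ p ∣ N * R →
      (haveI : NeZero p := ⟨hp.ne_zero⟩; heckeT (Gamma0 N) k p f) = a p • f)
    {M : ℕ} [NeZero M] (hM : M ∈ N.properDivisors) (h : CuspForm (Gamma0 M) k)
    (hh : ∀ (p : ℕ) (hp : p.Prime), ¬ p ∣ N * R →
      (haveI : NeZero p := ⟨hp.ne_zero⟩; heckeT (Gamma0 M) k p h) = a p • h) :
    (qExpansion 1 ⇑h).coeff 1 = 0 := by
  haveI : NeZero (N * R) := ⟨mul_ne_zero (NeZero.ne N) (NeZero.ne R)⟩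
  have hMN : M * 1 ∣ N := by simpa using (Nat.mem_properDivisors.mp hM).1
  set c₁ : ℂ := (qExpansion 1 ⇑f).coeff 1 with hc₁
  set e₁ : ℂ := (qExpansion 1 ⇑h).coeff 1 with he₁
  set v : CuspForm (Gamma0 N) k := c₁ • iota M N 1 k hMN h - e₁ • f with hv
  have hcoe : ∀ n, (qExpansion 1 ⇑(iota M N 1 k hMN h)).coeff n = (qExpansion 1 ⇑h).coeff n :=
    fun n ↦ by rw [qExpansion_coeff_iota]; simp
  have hvT : ∀ (p : ℕ) (hp : p.Prime), ¬ p ∣ N * R →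
      (haveI : NeZero p := ⟨hp.ne_zero⟩; heckeT (Gamma0 N) k p v) = a p • v := by
    intro p hp hpNR
    haveI : NeZero p := ⟨hp.ne_zero⟩
    have hpN : ¬ p ∣ N := fun h' ↦ hpNR (dvd_mul_of_dvd_left h' R)
    rw [hv, map_sub, map_smul, map_smul, heckeT_iota hMN hp hpN, hh p hp hpNR, hfT p hp hpNR,
      map_smul, smul_sub, smul_comm (a p) c₁, smul_comm (a p) e₁]
  have hv1 : (qExpansion 1 ⇑v).coeff 1 = 0 := by
    rw [hv, qExpansion_coeff_sub_level0, qExpansion_coeff_smul, qExpansion_coeff_smul, hcoe,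
      ← hc₁, ← he₁, mul_comm, sub_self]
  have hvold : v ∈ oldSubspace0 N k := mem_oldSubspace0_of_coeff_eq_zero_of_coprime v
    (coeff_eq_zero_of_coprime_of_forall_heckeT_eq_smul_of_dvd (dvd_mul_right N R) v a hvT hv1)
  have hιold : iota M N 1 k hMN h ∈ oldSubspace0 N k :=
    range_iota_le_oldSubspace0 M N 1 k hMN hM (LinearMap.mem_range_self _ h)
  have hold : e₁ • f ∈ oldSubspace0 N k := by
    have : e₁ • f = c₁ • iota M N 1 k hMN h - v := by rw [hv, sub_sub_cancel]
    rw [this]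
    exact Submodule.sub_mem _ (Submodule.smul_mem _ _ hιold) hvold
  have hzero : e₁ • f = 0 := (Submodule.disjoint_def.mp (disjoint_oldSubspace0_newSubspace0_holds N k))
    _ hold (Submodule.smul_mem _ _ hfnew)
  exact (smul_eq_zero.mp hzero).resolve_right hf0

/-- **The eigenvalue package, off `N R`, of a new eigenform of level `N` does not occur at lower
levels** (auxiliary-modulus form of `eq_zero_of_equiv_of_mem_properDivisors`; Atkin–Lehner 1970,
Thm. 5 / Knapp Thm. 9.22 with a finite exceptional set of primes, cf. Atkin–Lehner 1970, Thm. 4 and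
Lemma 26): for every proper divisor `M` of `N`,
`{h ∈ S_k(Γ₀(M)) : T_p h = λ_p h, p ∤ N R} = 0`, by strong induction on `M` via the adjoint
degeneracy maps (`adjDegeneracyMap0_heckeT`). [cite: AtkinLehner1970, Thm. 4 and Lemma 26] -/
theorem eq_zero_of_equiv_of_mem_properDivisors_off (hf0 : f ≠ 0) (hfnew : f ∈ newSubspace0 N k)
    (hfT : ∀ (p : ℕ) (hp : p.Prime), ¬ p ∣ N * R →
      (haveI : NeZero p := ⟨hp.ne_zero⟩; heckeT (Gamma0 N) k p f) = a p • f) :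
    ∀ (M : ℕ) [NeZero M], M ∈ N.properDivisors → ∀ h : CuspForm (Gamma0 M) k,
      (∀ (p : ℕ) (hp : p.Prime), ¬ p ∣ N * R →
        (haveI : NeZero p := ⟨hp.ne_zero⟩; heckeT (Gamma0 M) k p h) = a p • h) → h = 0 := by
  haveI : NeZero (N * R) := ⟨mul_ne_zero (NeZero.ne N) (NeZero.ne R)⟩
  intro M
  induction M using Nat.strong_induction_on with
  | _ M ih =>
    intro _ hM h hh
    have hMN : M ∣ N := (Nat.mem_properDivisors.mp hM).1
    have hMlt : M < N := (Nat.mem_properDivisors.mp hM).2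
    -- `h` is new at level `M`
    have hnew : h ∈ newSubspace0 M k := by
      rw [newSubspace0, Submodule.mem_iInf]
      intro Md
      rw [LinearMap.mem_ker]
      have hM'M : Md.1.1 ∣ M := (Nat.mem_properDivisors.mp Md.2.1).1
      have hM'lt : Md.1.1 < M := (Nat.mem_properDivisors.mp Md.2.1).2
      refine ih Md.1.1 hM'lt (Nat.mem_properDivisors.mpr ⟨hM'M.trans hMN, hM'lt.trans hMlt⟩)
        (adjDegeneracyMap0 M Md.1.1 Md.1.2 k h) fun p hp hpNR ↦ ?_
      haveI : NeZero p := ⟨hp.ne_zero⟩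
      have hpM : ¬ p ∣ M := fun h' ↦ hpNR (dvd_mul_of_dvd_left (h'.trans hMN) R)
      rw [← adjDegeneracyMap0_heckeT Md.2.2 hp hpM, hh p hp hpNR, map_smul]
    -- `h` is old at level `M`
    have h1 : (qExpansion 1 ⇑h).coeff 1 = 0 :=
      coeff_one_eq_zero_of_equiv_off hf0 hfnew hfT hM h hh
    have hold : h ∈ oldSubspace0 M k := mem_oldSubspace0_of_coeff_eq_zero_of_coprime h
      (coeff_eq_zero_of_coprime_of_forall_heckeT_eq_smul_of_dvd (hMN.trans (dvd_mul_right N R))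
        h a hh h1)
    exact (Submodule.disjoint_def.mp (disjoint_oldSubspace0_newSubspace0_holds M k)) h hold hnew

/-- **An eigenform equivalent, off `N R`, to a new eigenform is new** (auxiliary-modulus form of
`mem_newSubspace0_of_equiv`): its adjoint degeneracy images are such eigenforms at proper-divisor
levels, where there are none. [cite: AtkinLehner1970, Thm. 4 and Lemma 26] -/
theorem mem_newSubspace0_of_equiv_off (hf0 : f ≠ 0) (hfnew : f ∈ newSubspace0 N k)
    (hfT : ∀ (p : ℕ) (hp : p.Prime), ¬ p ∣ N * R →
      (haveI : NeZero p := ⟨hp.ne_zero⟩; heckeT (Gamma0 N) k p f) = a p • f)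
    (g : CuspForm (Gamma0 N) k)
    (hg : ∀ (p : ℕ) (hp : p.Prime), ¬ p ∣ N * R →
      (haveI : NeZero p := ⟨hp.ne_zero⟩; heckeT (Gamma0 N) k p g) = a p • g) :
    g ∈ newSubspace0 N k := by
  rw [newSubspace0, Submodule.mem_iInf]
  intro Md
  rw [LinearMap.mem_ker]
  refine eq_zero_of_equiv_of_mem_properDivisors_off hf0 hfnew hfT Md.1.1 Md.2.1
    (adjDegeneracyMap0 N Md.1.1 Md.1.2 k g) fun p hp hpNR ↦ ?_
  haveI : NeZero p := ⟨hp.ne_zero⟩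
  have hpN : ¬ p ∣ N := fun h' ↦ hpNR (dvd_mul_of_dvd_left h' R)
  rw [← adjDegeneracyMap0_heckeT Md.2.2 hp hpN, hg p hp hpNR, map_smul]

/-- **Strong multiplicity one on `Γ₀(N)`, off finitely many primes, for an arbitrary competitor.**
Let `f ≠ 0` lie in the new subspace `S_k(Γ₀(N))^{new}` with `T_p f = λ_p f` for all primes
`p ∤ N R` (`R ≥ 1` an auxiliary modulus). Then every `g ∈ S_k(Γ₀(N))` — old, new or neither — with
`T_p g = λ_p g` for all primes `p ∤ N R` is a scalar multiple of `f`. This is Atkin–Lehner 1970,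
Thm. 4 with Lemma 26 (a newform is determined, among forms of its level, by its eigenvalues at all
but finitely many primes; Diamond–Shurman Thm. 5.8.2 / Ex. 5.8.4; Miyake Thm. 4.6.19), in the
tree's algebraic setting: `g` is new (`mem_newSubspace0_of_equiv_off`), `v = a₁(f) g - a₁(g) f` is
new, an eigenform off `N R` with `a₁(v) = 0`, hence old (recursion and Main Lemma with sieve modulus
`N R`), hence `0`; and `a₁(f) ≠ 0`. [cite: AtkinLehner1970, Thm. 4 and Lemma 26] -/
theorem mem_span_of_equiv_of_mem_newSubspace0_off (hf0 : f ≠ 0) (hfnew : f ∈ newSubspace0 N k)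
    (hfT : ∀ (p : ℕ) (hp : p.Prime), ¬ p ∣ N * R →
      (haveI : NeZero p := ⟨hp.ne_zero⟩; heckeT (Gamma0 N) k p f) = a p • f)
    (g : CuspForm (Gamma0 N) k)
    (hg : ∀ (p : ℕ) (hp : p.Prime), ¬ p ∣ N * R →
      (haveI : NeZero p := ⟨hp.ne_zero⟩; heckeT (Gamma0 N) k p g) = a p • g) :
    g ∈ Submodule.span ℂ ({f} : Set (CuspForm (Gamma0 N) k)) := by
  haveI : NeZero (N * R) := ⟨mul_ne_zero (NeZero.ne N) (NeZero.ne R)⟩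
  have hgnew : g ∈ newSubspace0 N k := mem_newSubspace0_of_equiv_off hf0 hfnew hfT g hg
  set c₁ : ℂ := (qExpansion 1 ⇑f).coeff 1 with hc₁
  set e₁ : ℂ := (qExpansion 1 ⇑g).coeff 1 with he₁
  have hc₁0 : c₁ ≠ 0 := coeff_one_ne_zero_of_mem_newSubspace0_off hf0 hfnew hfT
  set v : CuspForm (Gamma0 N) k := c₁ • g - e₁ • f with hv
  have hvT : ∀ (p : ℕ) (hp : p.Prime), ¬ p ∣ N * R →
      (haveI : NeZero p := ⟨hp.ne_zero⟩; heckeT (Gamma0 N) k p v) = a p • v := by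
    intro p hp hpNR
    haveI : NeZero p := ⟨hp.ne_zero⟩
    rw [hv, map_sub, map_smul, map_smul, hg p hp hpNR, hfT p hp hpNR, smul_sub, smul_comm (a p) c₁,
      smul_comm (a p) e₁]
  have hv1 : (qExpansion 1 ⇑v).coeff 1 = 0 := by
    rw [hv, qExpansion_coeff_sub_level0, qExpansion_coeff_smul, qExpansion_coeff_smul, ← hc₁, ← he₁,
      mul_comm, sub_self]
  have hvold : v ∈ oldSubspace0 N k := mem_oldSubspace0_of_coeff_eq_zero_of_coprime v
    (coeff_eq_zero_of_coprime_of_forall_heckeT_eq_smul_of_dvd (dvd_mul_right N R) v a hvT hv1)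
  have hvnew : v ∈ newSubspace0 N k :=
    Submodule.sub_mem _ (Submodule.smul_mem _ _ hgnew) (Submodule.smul_mem _ _ hfnew)
  have hv0 : v = 0 :=
    (Submodule.disjoint_def.mp (disjoint_oldSubspace0_newSubspace0_holds N k)) v hvold hvnew
  have hcg : c₁ • g = e₁ • f := by rw [← sub_eq_zero, ← hv, hv0]
  refine Submodule.mem_span_singleton.mpr ⟨c₁⁻¹ * e₁, ?_⟩
  rw [mul_smul, ← hcg, smul_smul, inv_mul_cancel₀ hc₁0, one_smul]

/-- **Strong multiplicity one for newforms on `Γ₀(N)` against an arbitrary competitor, off finitely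
many primes**: if `f` is a newform on `Γ₀(N)` (`IsNewform0 f`) and `g ∈ S_k(Γ₀(N))` satisfies
`T_p g = a_p(f) g` for every prime `p ∤ N R`, then `g = a₁(g) • f`; in particular `g` is then an
eigenvector of **every** `T_p` with the eigenvalue `a_p(f)` of `f` (Atkin–Lehner 1970, Thm. 4 with
Lemma 26 and Thm. 5; Diamond–Shurman Thm. 5.8.2). [cite: AtkinLehner1970, Thm. 4 and Lemma 26] -/
theorem IsNewform0.eq_smul_of_heckeT_eq_smul_off (hf : IsNewform0 f) (g : CuspForm (Gamma0 N) k)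
    (hg : ∀ (p : ℕ) (hp : p.Prime), ¬ p ∣ N * R →
      (haveI : NeZero p := ⟨hp.ne_zero⟩; heckeT (Gamma0 N) k p g) = (qExpansion 1 ⇑f).coeff p • g) :
    g = (qExpansion 1 ⇑g).coeff 1 • f := by
  have hf0 : f ≠ 0 := by
    rintro rfl
    have h1 : (qExpansion 1 ⇑(0 : CuspForm (Gamma0 N) k)).coeff 1 = 1 := hf.2.2
    rw [CuspForm.coe_zero, UpperHalfPlane.qExpansion_zero] at h1
    simp at h1
  have hfT : ∀ (p : ℕ) (hp : p.Prime), ¬ p ∣ N * R →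
      (haveI : NeZero p := ⟨hp.ne_zero⟩; heckeT (Gamma0 N) k p f) = (qExpansion 1 ⇑f).coeff p • f :=
    fun p hp _ ↦ by
      haveI : NeZero p := ⟨hp.ne_zero⟩
      exact hf.heckeT_eq_coeff_smul hp
  obtain ⟨c, hc⟩ := Submodule.mem_span_singleton.mp
    (mem_span_of_equiv_of_mem_newSubspace0_off (a := fun p ↦ (qExpansion 1 ⇑f).coeff p) hf0 hf.1
      hfT g hg)
  have hc1 : (qExpansion 1 ⇑g).coeff 1 = c := by
    rw [← hc, qExpansion_coeff_smul, show (qExpansion 1 ⇑f).coeff 1 = 1 from hf.2.2, mul_one]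
  rw [hc1, hc]

end OffPrimes

/-! ## Part 2. Integrality of all Fourier coefficients from integrality at the primes -/

section Recursion

variable {N : ℕ} [NeZero N] {k : ℤ} {f : CuspForm (Gamma0 N) k}

/-- **A newform with integral `a_p` at every prime has integral `aₙ` for every `n`.** For a
newform `f ∈ S_k(Γ₀(N))`, `k ≥ 1`, the eigen-equations `T_p f = a_p(f) f` (all primes `p`, `U_p`
for `p ∣ N`) read on `q`-expansions (`qExpansion_coeff_heckeT_holds`, Diamond–Shurman Prop. 5.3.1 /
(5.3)): `a_{pm} = a_p a_m - 𝟙_N(p) p^{k-1} 𝟙_{p ∣ m} a_{m/p}` (Diamond–Shurman Prop. 5.8.5: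
`a_{p^r}(f)` and `a_{mn}(f)` are integer polynomials in the `a_p(f)`); so by strong induction on
`n = p m` (`p` the least prime factor), all `aₙ(f)` are integers once the `a_p(f)` are, `a₀ = 0`,
`a₁ = 1`. [cite: DiamondShurman2005, Prop. 5.8.5] -/
theorem IsNewform0.exists_int_eq_cuspCoeff (hf : IsNewform0 f) (hk : 1 ≤ k)
    (hprime : ∀ p : ℕ, p.Prime → ∃ z : ℤ, (z : ℂ) = (qExpansion 1 ⇑f).coeff p) (n : ℕ) :
    ∃ z : ℤ, cuspCoeff f n = z := by
  obtain ⟨m₀, hm₀⟩ : ∃ m₀ : ℕ, k - 1 = m₀ := ⟨(k - 1).toNat, (Int.toNat_of_nonneg (by omega)).symm⟩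
  induction n using Nat.strong_induction_on with
  | _ n ih =>
    rcases Nat.lt_or_ge n 2 with hn | hn
    · interval_cases n
      · exact ⟨0, by
          rw [cuspCoeff, CuspFormClass.qExpansion_coeff_zero f one_pos (one_mem_strictPeriods_gamma0 N),
            Int.cast_zero]⟩
      · exact ⟨1, by rw [Int.cast_one]; exact (isNormalized_iff_cuspCoeff_one f).mp hf.2.2⟩
    · have hn1 : n ≠ 1 := by omega
      set p := n.minFac with hp_def
      have hp : p.Prime := Nat.minFac_prime hn1
      haveI : NeZero p := ⟨hp.ne_zero⟩
      obtain ⟨m, hm⟩ : p ∣ n := Nat.minFac_dvd n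
      have hm0 : 0 < m := Nat.pos_of_ne_zero (by rintro rfl; simp at hm; omega)
      have hmlt : m < n := by rw [hm]; exact lt_mul_left hm0 hp.one_lt
      have key := qExpansion_coeff_heckeT_holds N k f p hp m
      rw [hf.heckeT_eq_coeff_smul hp, qExpansion_coeff_smul] at key
      obtain ⟨zp, hzp⟩ := hprime p hp
      obtain ⟨zm, hzm⟩ := ih m hmlt
      obtain ⟨zq, hzq⟩ := ih (m / p) ((Nat.div_le_self m p).trans_lt hmlt)
      rw [cuspCoeff] at hzm hzq
      refine ⟨zp * zm - (if p ∣ N then 0 else (p : ℤ) ^ m₀ * (if p ∣ m then zq else 0)), ?_⟩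
      rw [cuspCoeff, hm, eq_sub_of_add_eq key.symm, ← hzp, hzm, hm₀, zpow_natCast]
      push_cast
      split_ifs <;> first | rfl | rw [hzq]

end Recursion

end Literature.NumberTheory.EllipticCurves.ModularForms

/-! ## Part 3. An element of `ℚ(S) ⊆ ℂ` fixed by every embedding `ℚ(S) → ℂ` is rational -/

namespace Literature.NumberTheory.Automorphic.BCDT

/-- **An algebraic number fixed by all conjugations is rational.** Let `S ⊆ ℂ` consist of algebraic
numbers and let `x ∈ ℚ(S)`. If every `ℚ`-embedding `φ : ℚ(S) → ℂ` fixes `x`, then `x ∈ ℚ`: otherwise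
the (separable) minimal polynomial of `x` has a second root `y ≠ x` in `ℂ`, the embedding
`ℚ(x) → ℂ`, `x ↦ y` extends to `ℚ(S)` (Mathlib `IntermediateField.exists_algHom_adjoin_of_splits`),
and moves `x`. (Elementary Galois theory; e.g. the fixed field of all embeddings of a number field
is `ℚ`.) [folklore] -/
theorem exists_ratCast_eq_of_forall_algHom_adjoin_apply_eq {S : Set ℂ}
    (hS : ∀ s ∈ S, IsIntegral ℚ s) {x : ℂ} (hx : x ∈ IntermediateField.adjoin ℚ S)
    (hfix : ∀ φ : IntermediateField.adjoin ℚ S →+* ℂ, φ ⟨x, hx⟩ = x) :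
    ∃ q : ℚ, (q : ℂ) = x := by
  classical
  have hSint : ∀ s ∈ S, IsIntegral ℚ s ∧ ((minpoly ℚ s).map (algebraMap ℚ ℂ)).Splits :=
    fun s hs ↦ ⟨hS s hs, IsAlgClosed.splits _⟩
  -- `x` is integral over `ℚ`
  have hxint : IsIntegral ℚ x := by
    have halg : Algebra.IsAlgebraic ℚ (IntermediateField.adjoin ℚ S) :=
      IntermediateField.isAlgebraic_adjoin hS
    have h1 : IsIntegral ℚ (⟨x, hx⟩ : IntermediateField.adjoin ℚ S) :=
      (halg.isAlgebraic _).isIntegral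
    simpa using h1.map (IntermediateField.val (IntermediateField.adjoin ℚ S))
  -- if `x ∉ ℚ`, the minimal polynomial has a second root `y ≠ x`
  by_contra hxQ
  have hdeg : (minpoly ℚ x).natDegree ≠ 1 := by
    intro h1
    obtain ⟨q, hq⟩ := minpoly.natDegree_eq_one_iff.mp h1
    exact hxQ ⟨q, by rw [← hq]; rfl⟩
  have hsep : (minpoly ℚ x).Separable := (minpoly.irreducible hxint).separable
  have hsplit : ((minpoly ℚ x).map (algebraMap ℚ ℂ)).Splits := IsAlgClosed.splits _
  have hcard : Fintype.card ((minpoly ℚ x).rootSet ℂ) = (minpoly ℚ x).natDegree :=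
    Polynomial.card_rootSet_eq_natDegree hsep hsplit
  have hpos : 0 < (minpoly ℚ x).natDegree := minpoly.natDegree_pos hxint
  have hlt : 1 < Fintype.card ((minpoly ℚ x).rootSet ℂ) := by rw [hcard]; omega
  have hxroot : x ∈ (minpoly ℚ x).rootSet ℂ :=
    Polynomial.mem_rootSet.mpr ⟨minpoly.ne_zero hxint, minpoly.aeval ℚ x⟩
  obtain ⟨⟨y, hy⟩, hyx⟩ := Fintype.exists_ne_of_one_lt_card hlt ⟨x, hxroot⟩
  have hyx' : y ≠ x := fun h ↦ hyx (Subtype.ext h)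
  have hy' : y ∈ (minpoly ℚ x).aroots ℂ := by
    rw [Polynomial.rootSet_def, Finset.mem_coe, Multiset.mem_toFinset] at hy
    exact hy
  -- the embedding `ℚ(x) → ℂ`, `x ↦ y`, extended to `ℚ(S)`
  have hle : IntermediateField.adjoin ℚ {x} ≤ IntermediateField.adjoin ℚ S :=
    IntermediateField.adjoin_simple_le_iff.mpr hx
  obtain ⟨φ, hφ⟩ := IntermediateField.exists_algHom_adjoin_of_splits hSint
    ((IntermediateField.algHomAdjoinIntegralEquiv ℚ hxint).symm ⟨y, hy'⟩) hle
  have h1 : φ ⟨x, hx⟩ = y := by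
    have h2 : (⟨x, hx⟩ : IntermediateField.adjoin ℚ S) =
        IntermediateField.inclusion hle (IntermediateField.AdjoinSimple.gen ℚ x) := rfl
    rw [h2, ← AlgHom.comp_apply, hφ, IntermediateField.algHomAdjoinIntegralEquiv_symm_apply_gen]
  have h3 : φ.toRingHom ⟨x, hx⟩ = x := hfix φ.toRingHom
  exact hyx' (h1.symm.trans h3)

end Literature.NumberTheory.Automorphic.BCDT

/-! ## Part 4. Rationality of all `a_p(f)` from rationality off finitely many primes -/

namespace Literature.NumberTheory.EllipticCurves.ModularForms

open Automorphic.BCDT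

section Conjugation

variable {N : ℕ} [NeZero N] {k : ℤ} {f : CuspForm (Gamma0 N) k}

/-- **A newform on `Γ₀(N)` whose eigenvalues `a_p` are rational for all but finitely many primes
has integral `a_p` at every prime** (`U_p`-eigenvalues for `p ∣ N` and the finitely many excluded
`T_p` included), granted Deligne–Serre's (2.7.2) at `(N, k)` (`DeligneSerre1974_span_integralLattice1 N k`:
`S_k(Γ₁(N))` is spanned by the lattice `L` of forms with integral twisted `q`-expansions; Shimura
1971, Thm. 3.52).  Proof — Deligne–Serre 1974, (2.7.4) ("pour tout automorphisme `σ` de `ℂ`, la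
forme `σ(f)` est telle que `σ(f)|T_p = σ(a_p) σ(f)`") combined with strong multiplicity one
(Atkin–Lehner 1970, Thm. 4): let `K₁ = ℚ(a_p(f) : p prime)` and `φ : K₁ → ℂ` an embedding.  In the
`ℂ`-basis of `S_k(Γ₁(N))` given by a `ℤ`-basis of `L` (`integralBasis`) all `T_p` and `⟨d⟩` have
integer matrices (`heckeT_mem_integralLattice1`, `diamondOp_mem_integralLattice1`), so the common
eigenvector `f` (lifted to `Γ₁(N)`, `⟨d⟩ f = f`) is transported along `φ`
(`LatticeEigen.exists_eigenvector_conj`) to `G ≠ 0` with `T_p G = φ(a_p) G` for all `p` and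
`⟨d⟩ G = G`; `G` descends to `g ∈ S_k(Γ₀(N))` (`exists_liftToGamma1_eq_of_forall_diamondOp_eq`).
For the primes `p ∤ N R` with `a_p ∈ ℚ`, `φ(a_p) = a_p`, so `g = a₁(g) f` by strong multiplicity one
off `N R` (`IsNewform0.eq_smul_of_heckeT_eq_smul_off`), whence `φ(a_p) = a_p` for **every** prime
`p`.  An element of `K₁` fixed by all embeddings is rational
(`exists_ratCast_eq_of_forall_algHom_adjoin_apply_eq`), and `a_p(f)` is an algebraic integer
(`IsNewform0.isIntegral_coeff_holds`, Shimura Thm. 3.48), hence an integer.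
[cite: DeligneSerreASENS1974, Prop. 2.7 (2.7.4)] [cite: AtkinLehner1970, Thm. 4] -/
theorem IsNewform0.exists_int_eq_coeff_prime_of_off (hf : IsNewform0 f) (hk : 1 ≤ k)
    (hL : DeligneSerre1974_span_integralLattice1 N k) {R : ℕ} [NeZero R]
    (hrat : ∀ p : ℕ, p.Prime → ¬ p ∣ N * R → ∃ q : ℚ, (q : ℂ) = (qExpansion 1 ⇑f).coeff p)
    (p : ℕ) (hp : p.Prime) : ∃ z : ℤ, (z : ℂ) = (qExpansion 1 ⇑f).coeff p := by
  classical
  have hspan := hL hk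
  have hf0 : f ≠ 0 := by
    rintro rfl
    have h1 : (qExpansion 1 ⇑(0 : CuspForm (Gamma0 N) k)).coeff 1 = 1 := hf.2.2
    rw [CuspForm.coe_zero, UpperHalfPlane.qExpansion_zero] at h1
    simp at h1
  set F : CuspForm (Gamma1 N) k := liftToGamma1 N k f with hF
  have hF0 : F ≠ 0 := liftToGamma1_ne_zero N k hf0
  -- the operators `𝒯 = {T_p : p prime} ∪ {⟨d⟩}` on `S_k(Γ₁(N))` and their eigenvalues on `F`
  set 𝒯 : Set (Module.End ℂ (CuspForm (Gamma1 N) k)) :=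
    {T | ∃ (p : ℕ) (hp : p.Prime), T = (haveI : NeZero p := ⟨hp.ne_zero⟩; heckeT (Gamma1 N) k p)} ∪
      {T | ∃ d : (ZMod N)ˣ, T = diamondOp N k (d : ZMod N)} with h𝒯
  have hTmem : ∀ (p : ℕ) (hp : p.Prime),
      (haveI : NeZero p := ⟨hp.ne_zero⟩; heckeT (Gamma1 N) k p) ∈ 𝒯 :=
    fun p hp ↦ Or.inl ⟨p, hp, rfl⟩
  have hdmem : ∀ d : (ZMod N)ˣ, diamondOp N k (d : ZMod N) ∈ 𝒯 := fun d ↦ Or.inr ⟨d, rfl⟩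
  have hstab : ∀ T ∈ 𝒯, ∀ x ∈ integralLattice1 N k, T x ∈ integralLattice1 N k := by
    rintro T (⟨p, hp, rfl⟩ | ⟨d, rfl⟩) x hx
    · haveI : NeZero p := ⟨hp.ne_zero⟩
      exact heckeT_mem_integralLattice1 hk hx p hp
    · exact diamondOp_mem_integralLattice1 hx d
  have hTF : ∀ (p : ℕ) (hp : p.Prime),
      (haveI : NeZero p := ⟨hp.ne_zero⟩; heckeT (Gamma1 N) k p F) = (qExpansion 1 ⇑f).coeff p • F := by
    intro p hp
    haveI : NeZero p := ⟨hp.ne_zero⟩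
    rw [hF, heckeT_liftToGamma1, hf.heckeT_eq_coeff_smul hp, map_smul]
  have hdF : ∀ d : (ZMod N)ˣ, diamondOp N k (d : ZMod N) F = F := fun d ↦
    diamondOp_liftToGamma1 N k (d : ZMod N) f
  set lam : Module.End ℂ (CuspForm (Gamma1 N) k) → ℂ := LatticeEigen.eigenvalueOf F with hlam
  have hlam_p : ∀ (p : ℕ) (hp : p.Prime),
      lam (haveI : NeZero p := ⟨hp.ne_zero⟩; heckeT (Gamma1 N) k p) = (qExpansion 1 ⇑f).coeff p :=
    fun p hp ↦ LatticeEigen.eigenvalueOf_eq hF0 (hTF p hp)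
  have hlam_d : ∀ d : (ZMod N)ˣ, lam (diamondOp N k (d : ZMod N)) = 1 := fun d ↦
    LatticeEigen.eigenvalueOf_eq hF0 (by rw [hdF d, one_smul])
  have hlam_eig : ∀ T ∈ 𝒯, T F = lam T • F := by
    rintro T (⟨p, hp, rfl⟩ | ⟨d, rfl⟩)
    · exact LatticeEigen.apply_eq_eigenvalueOf_smul ⟨_, hTF p hp⟩
    · exact LatticeEigen.apply_eq_eigenvalueOf_smul ⟨1, by rw [hdF d, one_smul]⟩
  have hint : ∀ T ∈ 𝒯, IsIntegral ℤ (lam T) := by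
    rintro T (⟨p, hp, rfl⟩ | ⟨d, rfl⟩)
    · rw [hlam_p p hp]
      exact IsNewform0.isIntegral_coeff_holds hf p
    · rw [hlam_d]
      exact isIntegral_one
  -- the field `K₁ = ℚ(λ_T : T ∈ 𝒯)`
  set S : Set ℂ := lam '' 𝒯 with hS
  have hSint : ∀ s ∈ S, IsIntegral ℚ s := by
    rintro _ ⟨T, hT, rfl⟩
    exact (hint T hT).tower_top
  set K₁ : IntermediateField ℚ ℂ := IntermediateField.adjoin ℚ S with hK₁
  have hlamK : ∀ T ∈ 𝒯, lam T ∈ K₁ := fun T hT ↦ IntermediateField.subset_adjoin ℚ S ⟨T, hT, rfl⟩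
  haveI : NeZero p := ⟨hp.ne_zero⟩
  have hapK : (qExpansion 1 ⇑f).coeff p ∈ K₁ := hlam_p p hp ▸ hlamK _ (hTmem p hp)
  -- `a_p(f)` is fixed by every embedding `φ : K₁ → ℂ`
  have hfix : ∀ φ : K₁ →+* ℂ, φ ⟨(qExpansion 1 ⇑f).coeff p, hapK⟩ = (qExpansion 1 ⇑f).coeff p := by
    intro φ
    -- transport of the eigenvector `F` along `φ`
    set b := integralBasis N k hspan with hb
    have hratb : ∀ T ∈ 𝒯, ∀ i j, ∃ q : ℚ, b.repr (T (b j)) i = q := fun T hT i j ↦ by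
      obtain ⟨n, hn⟩ := exists_int_repr_integralBasis hspan T (hstab T hT) i j
      exact ⟨n, by rw [hn, Rat.cast_intCast]⟩
    obtain ⟨G, hG0, hG⟩ :=
      LatticeEigen.exists_eigenvector_conj b 𝒯 hratb K₁ φ hF0 lam hlamK hlam_eig
    -- `G` is fixed by the diamond operators, hence comes from `Γ₀(N)`
    have hGd : ∀ d : (ZMod N)ˣ, diamondOp N k (d : ZMod N) G = G := by
      intro d
      rw [hG _ (hdmem d)]
      have h1 : (⟨lam (diamondOp N k (d : ZMod N)), hlamK _ (hdmem d)⟩ : K₁) = 1 :=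
        Subtype.ext (hlam_d d)
      rw [h1, map_one, one_smul]
    obtain ⟨g, hg⟩ := exists_liftToGamma1_eq_of_forall_diamondOp_eq k G fun d hd ↦ by
      obtain ⟨u, rfl⟩ := hd
      exact hGd u
    have hg0 : g ≠ 0 := by
      rintro rfl
      exact hG0 (by rw [← hg, map_zero])
    -- `T_q g = φ(a_q) g` for every prime `q`
    have hgT : ∀ (q : ℕ) (hq : q.Prime),
        (haveI : NeZero q := ⟨hq.ne_zero⟩; heckeT (Gamma0 N) k q g) =
          φ ⟨(qExpansion 1 ⇑f).coeff q, hlam_p q hq ▸ hlamK _ (hTmem q hq)⟩ • g := by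
      intro q hq
      haveI : NeZero q := ⟨hq.ne_zero⟩
      apply liftToGamma1_injective
      have h1 : (⟨(qExpansion 1 ⇑f).coeff q, hlam_p q hq ▸ hlamK _ (hTmem q hq)⟩ : K₁) =
          ⟨lam (heckeT (Gamma1 N) k q), hlamK _ (hTmem q hq)⟩ := Subtype.ext (hlam_p q hq).symm
      rw [← heckeT_liftToGamma1, map_smul, hg, h1]
      exact hG _ (hTmem q hq)
    -- off `N R` the eigenvalues are rational, hence fixed by `φ`
    have hgT' : ∀ (q : ℕ) (hq : q.Prime), ¬ q ∣ N * R →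
        (haveI : NeZero q := ⟨hq.ne_zero⟩; heckeT (Gamma0 N) k q g) = (qExpansion 1 ⇑f).coeff q • g := by
      intro q hq hqNR
      obtain ⟨r, hr⟩ := hrat q hq hqNR
      rw [hgT q hq]
      congr 1
      have h1 : (⟨(qExpansion 1 ⇑f).coeff q, hlam_p q hq ▸ hlamK _ (hTmem q hq)⟩ : K₁) = (r : K₁) :=
        Subtype.ext (show (qExpansion 1 ⇑f).coeff q = ((r : K₁) : ℂ) by rw [← hr]; norm_cast)
      rw [h1, map_ratCast, hr]
    -- strong multiplicity one off `N R`: `g = a₁(g) f`, so `T_p g = a_p g`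
    have hgf : g = (qExpansion 1 ⇑g).coeff 1 • f := hf.eq_smul_of_heckeT_eq_smul_off g hgT'
    have h2 : heckeT (Gamma0 N) k p g = (qExpansion 1 ⇑f).coeff p • g := by
      conv_lhs => rw [hgf, map_smul, hf.heckeT_eq_coeff_smul hp]
      rw [smul_comm, ← hgf]
    rw [hgT p hp] at h2
    exact smul_left_injective ℂ hg0 h2
  -- hence rational, hence (being an algebraic integer) an integer
  obtain ⟨q, hq⟩ := exists_ratCast_eq_of_forall_algHom_adjoin_apply_eq hSint hapK hfix
  have hqint : IsIntegral ℤ q := by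
    have h := IsNewform0.isIntegral_coeff_holds hf p
    rw [← hq, show ((q : ℚ) : ℂ) = algebraMap ℚ ℂ q from rfl] at h
    exact (isIntegral_algebraMap_iff (algebraMap ℚ ℂ).injective).mp h
  obtain ⟨z, hz⟩ := IsIntegrallyClosed.isIntegral_iff.mp hqint
  exact ⟨z, by rw [← hq, ← hz]; simp⟩

end Conjugation

end Literature.NumberTheory.EllipticCurves.ModularForms

/-! ## Part 5. From "`ρ_{E,ℓ}` is modular" to a rational newform on `Γ₀(N)` matching `a_p(E)` -/

namespace Literature.NumberTheory.Automorphic.BCDT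

open WeierstrassCurve GaloisRepresentations EllipticCurves EllipticCurves.ModularForms
  Rat.HeightOneSpectrum IsDedekindDomain IsDedekindDomain.HeightOneSpectrum
open scoped NumberField

/-- The `X`-coefficient of `X² - a X + b` is `-a`. [folklore] -/
private theorem coeff_one_X_sq_sub_C_mul_X_add_C {S : Type*} [CommRing S] (a b : S) :
    (Polynomial.X ^ 2 - Polynomial.C a * Polynomial.X + Polynomial.C b).coeff 1 = -a := by
  simp [Polynomial.coeff_X_pow, Polynomial.coeff_C]

/-- **"`ρ_{E,ℓ}` modular" yields a newform on `Γ₀(N)` with `a_p(f) = a_p(E)` off `N ℓ N_E`.**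
If `ρ_{E,ℓ}` is modular (`W.IsModularGaloisRepTate ℓ`), there are `N ≥ 1` and a newform
`f ∈ S₂(Γ₀(N))` (`IsNewform0`) with `a_p(f) = a_p(E)` for every prime `p ∤ N ℓ N_E`.  Indeed the
eigenform may be taken of weight `2` with trivial character (`isModularGaloisRepTate_iff_weight_two`),
so it is fixed by the diamond operators (`IsNewform1.diamondOp_apply_eq_nebentypus_smul`) and
descends to a newform on `Γ₀(N)` (`exists_liftToGamma1_eq_of_forall_diamondOp_eq`,
`isNewform1_liftToGamma1_iff_holds`; Diamond–Shurman §4.3, `S_k(Γ₀(N)) = S_k(N, 𝟙)`); and at a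
prime `p ∤ N ℓ` of good reduction the `X`-coefficients of
`char(Frob_p | T_ℓ E) = ι(X² - a_p(f) X + p)` give `ι(a_p(f)) = tr(Frob_p | T_ℓ E) = a_p(E)`
(`trace_galoisRepTate_frobenius_of_hasGoodReductionAt_holds`, Silverman *AEC* C.21.3;
`lFunction_primesEquiv_eq_frobeniusTraceAt`), and `ι` is injective (Breuil–Conrad–Diamond–Taylor
2001, Introduction: `tr ρ_{f,λ}(Frob_p) = a_p(f)` versus (1) `a_p(E) = tr ρ_{E,ℓ}(Frob_p)`).
[cite: BCDTJAMS2001, Introduction (conditions (1)–(4))] -/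
theorem exists_isNewform0_cuspCoeff_eq_lFunction_of_isModularGaloisRepTate (W : WeierstrassCurve ℚ)
    [W.IsElliptic] (ℓ : ℕ) [Fact ℓ.Prime] (h : W.IsModularGaloisRepTate ℓ) :
    ∃ (N : ℕ) (_ : NeZero N) (f : CuspForm (Gamma0 N) 2), IsNewform0 f ∧
      ∀ p : ℕ, p.Prime → ¬ p ∣ N * (ℓ * W.conductorNorm ℤ) → cuspCoeff f p = (W.LFunction p : ℂ) := by
  classical
  have hℓp : ℓ.Prime := Fact.out
  obtain ⟨N, hN, f, K, hK, hA, ι, hnew, hε, hcl⟩ := (isModularGaloisRepTate_iff_weight_two W ℓ).mp h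
  -- descent to `Γ₀(N)`
  have hdia : ∀ d : ZMod N, IsUnit d → diamondOp N 2 d f = f := by
    intro d hd
    obtain ⟨u, rfl⟩ := hd
    rw [hnew.diamondOp_apply_eq_nebentypus_smul u, hε, MulChar.one_apply_coe, one_smul]
  obtain ⟨f₀, hf₀⟩ := exists_liftToGamma1_eq_of_forall_diamondOp_eq 2 f hdia
  have hnew₀ : IsNewform0 f₀ := (isNewform1_liftToGamma1_iff_holds N 2 f₀).mp (hf₀ ▸ hnew)
  have hcoe : (⇑f₀ : UpperHalfPlane → ℂ) = ⇑f := by rw [← hf₀, coe_liftToGamma1_holds]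
  refine ⟨N, hN, f₀, hnew₀, fun p hp hpM ↦ ?_⟩
  have hpNℓ : ¬ p ∣ N * ℓ := fun h' ↦ hpM (by rw [← mul_assoc]; exact dvd_mul_of_dvd_left h' _)
  have hpE : ¬ p ∣ W.conductorNorm ℤ := fun h' ↦
    hpM (dvd_mul_of_dvd_right (dvd_mul_of_dvd_right h' ℓ) N)
  -- the place `v` of `ℚ` at `p`, a prime of `ℤ̄` above it and an arithmetic Frobenius
  obtain ⟨v, rfl⟩ : ∃ v : HeightOneSpectrum (𝓞 ℚ), (primesEquiv v : ℕ) = p :=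
    ⟨primesEquiv.symm ⟨p, hp⟩, by rw [Equiv.apply_symm_apply]⟩
  obtain ⟨𝔓, h𝔓⟩ := primesAbove_nonempty v
  obtain ⟨σ, hσ⟩ := exists_isArithFrobAt_of_mem_primesAbove_holds (v := v) h𝔓
  have hpℓ : (primesEquiv v : ℕ) ≠ ℓ := fun h' ↦ hpNℓ (by rw [← h']; exact dvd_mul_left _ _)
  have hgood : W.HasGoodReductionAt v := by
    by_contra h'
    exact hpE ((W.dvd_conductorNorm_iff v).mpr h')
  have hℓv : ((ℓ : ℕ) : 𝓞 ℚ) ∉ v.asIdeal := by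
    rw [GaloisRepresentations.Rat.natCast_mem_asIdeal_iff]
    exact fun h' ↦ hpℓ ((Nat.prime_dvd_prime_iff_eq hp hℓp).mp h')
  have htr := W.trace_galoisRepTate_frobenius_of_hasGoodReductionAt_holds ℓ v hℓv hgood h𝔓 hσ
  -- compare the `X`-coefficients of the two characteristic polynomials
  have h1 := congrArg (fun P : Polynomial K ↦ P.coeff 1) ((hcl v hpNℓ 𝔓 h𝔓).2 σ hσ)
  rw [Polynomial.coeff_map, Polynomial.coeff_map, coeff_one_X_sq_sub_C_mul_X_add_C, heckePolynomial,
    coeff_one_X_sq_sub_C_mul_X_add_C, map_neg, map_neg, neg_inj, htr, map_intCast,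
    ← map_intCast ι] at h1
  have h2 := congrArg Subtype.val (ι.injective h1)
  change (((W.frobeniusTraceAt v : ℤ) : coeffCharField f) : ℂ) =
    (qExpansion 1 ⇑f).coeff (primesEquiv v : ℕ) at h2
  rw [cuspCoeff, hcoe, W.lFunction_primesEquiv_eq_frobeniusTraceAt hgood, ← h2]
  norm_cast

/-! ## Part 6. (3) ⇒ (2) from the catalogued facts; CDT Theorem 7.2.2 versus its `5`-adic form -/

/-- **"`ρ_{E,ℓ}` modular" yields a RATIONAL newform on `Γ₀(N)` with `a_p(f) = a_p(E)` off
`N ℓ N_E`**, granted Deligne–Serre (2.7.2) in weight `2` (`hL`): combine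
`exists_isNewform0_cuspCoeff_eq_lFunction_of_isModularGaloisRepTate` (a newform `f ∈ S₂(Γ₀(N))`
with `a_p(f) = a_p(E) ∈ ℤ` for `p ∤ N ℓ N_E`) with `IsNewform0.exists_int_eq_coeff_prime_of_off`
(conjugation and strong multiplicity one: every `a_p(f) ∈ ℤ`) and `IsNewform0.exists_int_eq_cuspCoeff`
(Hecke recursions: every `aₙ(f) ∈ ℤ`).  This is the input required by the Eichler–Shimura
construction. [cite: BCDTJAMS2001, Introduction ((3) ⇒ (2))] -/
theorem exists_rational_isNewform0_of_isModularGaloisRepTate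
    (hL : ∀ (N : ℕ) [NeZero N], DeligneSerre1974_span_integralLattice1 N 2)
    (W : WeierstrassCurve ℚ) [W.IsElliptic] (ℓ : ℕ) [Fact ℓ.Prime] (h : W.IsModularGaloisRepTate ℓ) :
    ∃ (N : ℕ) (_ : NeZero N) (f : CuspForm (Gamma0 N) 2), IsNewform0 f ∧
      (∀ n : ℕ, ∃ z : ℤ, cuspCoeff f n = z) ∧
      ∀ p : ℕ, p.Prime → ¬ p ∣ N * (ℓ * W.conductorNorm ℤ) → cuspCoeff f p = (W.LFunction p : ℂ) := by
  have hℓp : ℓ.Prime := Fact.out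
  obtain ⟨N, hN, f, hf, hcoeff⟩ :=
    exists_isNewform0_cuspCoeff_eq_lFunction_of_isModularGaloisRepTate W ℓ h
  haveI : NeZero (ℓ * W.conductorNorm ℤ) :=
    ⟨mul_ne_zero hℓp.ne_zero (conductorNorm_pos_holds W).ne'⟩
  have hprime : ∀ p : ℕ, p.Prime → ∃ z : ℤ, (z : ℂ) = (qExpansion 1 ⇑f).coeff p :=
    hf.exists_int_eq_coeff_prime_of_off (by norm_num) (hL N) (R := ℓ * W.conductorNorm ℤ)
      fun p hp hpM ↦ ⟨W.LFunction p, by rw [Rat.cast_intCast]; exact (hcoeff p hp hpM).symm⟩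
  exact ⟨N, hN, f, hf, hf.exists_int_eq_cuspCoeff (by norm_num) hprime, hcoeff⟩

/-- **Breuil–Conrad–Diamond–Taylor 2001, Introduction, (3) ⇒ (2): if `ρ_{E,ℓ}` is modular then `E`
is modular** — *"The implication (3) ⇒ (2) follows from a theorem of Carayol [Ca1] and a theorem of
Faltings [Fa2]"* — PROVED from the tree's catalogued named facts:

* `hL` — Deligne–Serre 1974, (2.7.2) in weight `2` (`DeligneSerre1974_span_integralLattice1 N 2` for
  all `N`; Shimura 1971, Thm. 3.52: `S₂(Γ₁(N))` has a basis in `ℤ[[q]]`), used for the conjugates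
  `σ(f)` of eigenforms;
* `hES` — the Eichler–Shimura construction (`eichlerShimuraConstruction`; Knapp Thm. 11.74 with
  Thm. 12.8): a rational newform `f ∈ S₂(Γ₀(N))` has an elliptic curve `E_f/ℚ` with
  `aₙ(E_f) = aₙ(f)`;
* `hF` — Faltings' isogeny theorem (`WeierstrassCurve.isIsogenous_iff_frobeniusTrace_eq`; Faltings
  1983, §5 Kor. 2);
* `hC` — Carayol's theorem, level `=` conductor (`IsNewformOf.level_eq_conductorNorm`; Carayol
  1986; Diamond–Shurman Thm. 8.8.1).

Proof.  By `exists_isNewform0_cuspCoeff_eq_lFunction_of_isModularGaloisRepTate`, `ρ_{E,ℓ}` modular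
gives a newform `f ∈ S₂(Γ₀(N))` with `a_p(f) = a_p(E) ∈ ℤ` for all primes `p ∤ N ℓ N_E`; by
conjugation and strong multiplicity one (`IsNewform0.exists_int_eq_coeff_prime_of_off`, using `hL`)
every `a_p(f)` is an integer, hence every `aₙ(f)` (`IsNewform0.exists_int_eq_cuspCoeff`); the
Eichler–Shimura curve `E_f` (`hES`) has `a_p(E_f) = a_p(f) = a_p(E)` off `N ℓ N_E`, so `E ~ E_f`
over `ℚ` by Faltings (`isIsogenous_of_finite_setOf_LFunction_ne`, `hF`), whence
`L(E, s) = L(E_f, s) = L(f, s)` (`IsIsogenous.LFunction_eq`, a theorem of the tree) and `f` is the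
newform of `E`; finally `N = N_E` by Carayol (`hC`). [cite: BCDTJAMS2001, Introduction ((3) ⇒ (2))] -/
theorem isModular_of_isModularGaloisRepTate_of_facts
    (hL : ∀ (N : ℕ) [NeZero N], DeligneSerre1974_span_integralLattice1 N 2)
    (hES : eichlerShimuraConstruction)
    (hF : WeierstrassCurve.isIsogenous_iff_frobeniusTrace_eq)
    (hC : ∀ (N : ℕ) [NeZero N], IsNewformOf.level_eq_conductorNorm (N := N))
    (W : WeierstrassCurve ℚ) [W.IsElliptic] [NeZero (W.conductorNorm ℤ)] (ℓ : ℕ) [Fact ℓ.Prime]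
    (h : W.IsModularGaloisRepTate ℓ) : IsModular W := by
  classical
  have hℓp : ℓ.Prime := Fact.out
  -- a rational newform `f ∈ S₂(Γ₀(N))` with `a_p(f) = a_p(E)` off `N ℓ N_E`
  obtain ⟨N, hN, f, hf, hint, hcoeff⟩ := exists_rational_isNewform0_of_isModularGaloisRepTate hL W ℓ h
  haveI : NeZero (N * (ℓ * W.conductorNorm ℤ)) :=
    ⟨mul_ne_zero (NeZero.ne N) (mul_ne_zero hℓp.ne_zero (NeZero.ne _))⟩
  -- the Eichler–Shimura curve `E_f` and Faltings: `E ~ E_f`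
  obtain ⟨W', hW', hW'f, -⟩ := hES hf hint
  have hiso : IsIsogenous W W' := by
    refine WeierstrassCurve.isIsogenous_of_finite_setOf_LFunction_ne hF W W' ?_
    refine (N * (ℓ * W.conductorNorm ℤ)).primeFactors.finite_toSet.subset ?_
    rintro p ⟨hp, hne⟩
    refine (Nat.mem_primeFactors_of_ne_zero (NeZero.ne _)).mpr ⟨hp, ?_⟩
    by_contra hpM
    exact hne (by exact_mod_cast (hcoeff p hp hpM).symm.trans (hW'f.2 p))
  -- `L(E, s) = L(E_f, s) = L(f, s)`, and the level is the conductor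
  have hWf : IsNewformOf W f := ⟨hf, fun n ↦ by rw [hW'f.2 n, hiso.LFunction_eq]⟩
  have hNE : N = W.conductorNorm ℤ := hC N hWf
  subst hNE
  exact ⟨f, hWf⟩

/-- **(3) ⇒ (2) at `ℓ = 5`**, the hypothesis `h32` of `CDTTheorem722`, from the catalogued facts
(`isModular_of_isModularGaloisRepTate_of_facts`). [cite: BCDTJAMS2001, Introduction ((3) ⇒ (2))] -/
theorem three_imp_two_of_facts
    (hL : ∀ (N : ℕ) [NeZero N], DeligneSerre1974_span_integralLattice1 N 2)
    (hES : eichlerShimuraConstruction)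
    (hF : WeierstrassCurve.isIsogenous_iff_frobeniusTrace_eq)
    (hC : ∀ (N : ℕ) [NeZero N], IsNewformOf.level_eq_conductorNorm (N := N)) :
    ∀ (W : WeierstrassCurve ℚ) [W.IsElliptic] [NeZero (W.conductorNorm ℤ)],
      W.IsModularGaloisRepTate 5 → IsModular W :=
  fun W _ _ h ↦ isModular_of_isModularGaloisRepTate_of_facts hL hES hF hC W 5 h

/-- **After Theorem A, conditions (2), (3), (4) agree — from the catalogued facts**: for an
elliptic `W / ℚ` and any prime `ℓ`, `E` is modular iff `ρ_{E,ℓ}` is modular ((2) ⇒ (4) being the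
theorem `IsModular.isModularGaloisRepTate`, (3) ⇒ (2) being
`isModular_of_isModularGaloisRepTate_of_facts`). [cite: BCDTJAMS2001, Introduction (conditions (2)–(4))] -/
theorem isModular_iff_isModularGaloisRepTate_of_facts
    (hL : ∀ (N : ℕ) [NeZero N], DeligneSerre1974_span_integralLattice1 N 2)
    (hES : eichlerShimuraConstruction)
    (hF : WeierstrassCurve.isIsogenous_iff_frobeniusTrace_eq)
    (hC : ∀ (N : ℕ) [NeZero N], IsNewformOf.level_eq_conductorNorm (N := N))
    (W : WeierstrassCurve ℚ) [W.IsElliptic] [NeZero (W.conductorNorm ℤ)] (ℓ : ℕ) [Fact ℓ.Prime] :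
    IsModular W ↔ W.IsModularGaloisRepTate ℓ :=
  ⟨fun h ↦ h.isModularGaloisRepTate ℓ, isModular_of_isModularGaloisRepTate_of_facts hL hES hF hC W ℓ⟩

/-- **Conrad–Diamond–Taylor 1999, Theorem 7.2.2 from its `5`-adic lifting statement and the
catalogued classical facts**: granted Deligne–Serre (2.7.2) in weight `2`, the Eichler–Shimura
construction, Faltings' isogeny theorem and Carayol's theorem (the named facts `hL`, `hES`, `hF`,
`hC`), the `5`-adic modularity lifting statement proved on pp. 553–554 of CDT (`hlift`: for every
elliptic `W / ℚ` and framed model `ρ̄` of `E[5]`, `ρ̄|_{ℚ(√5)}` absolutely irreducible and `ρ̄`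
modular imply `ρ_{E,5}` modular) implies the named fact `CDT_theorem_7_2_2`
(`CDT_theorem_7_2_2_of_lift_of_three_imp_two` with `three_imp_two_of_facts`).
[cite: ConradDiamondTaylor1999, Thm. 7.2.2 (proof, pp. 553–554)] -/
theorem CDT_theorem_7_2_2_of_lift_of_facts
    (hL : ∀ (N : ℕ) [NeZero N], DeligneSerre1974_span_integralLattice1 N 2)
    (hES : eichlerShimuraConstruction)
    (hF : WeierstrassCurve.isIsogenous_iff_frobeniusTrace_eq)
    (hC : ∀ (N : ℕ) [NeZero N], IsNewformOf.level_eq_conductorNorm (N := N))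
    (hlift : ∀ (W : WeierstrassCurve ℚ) [W.IsElliptic] (ρ : ModPGaloisRep ℚ (ZMod 5) 2),
      W.IsTorsionGaloisRep 5 ρ → ρ.IsAbsIrreducibleOverSqrt 5 → ρ.IsModular →
      W.IsModularGaloisRepTate 5) :
    CDT_theorem_7_2_2 :=
  CDT_theorem_7_2_2_of_lift_of_three_imp_two hlift (three_imp_two_of_facts hL hES hF hC)

/-- **Inside the tree, CDT Theorem 7.2.2 is equivalent to its `5`-adic (Galois-theoretic) form,
granted only catalogued classical facts** (Deligne–Serre (2.7.2) in weight `2`, Eichler–Shimura,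
Faltings, Carayol): what the named fact `CDT_theorem_7_2_2` asserts beyond them is exactly the
`5`-adic modularity lifting statement of pp. 553–554 of CDT (`CDT_theorem_7_2_2_iff_lift` with
`three_imp_two_of_facts`). [cite: ConradDiamondTaylor1999, Thm. 7.2.2 (proof, pp. 553–554)] -/
theorem CDT_theorem_7_2_2_iff_lift_of_facts
    (hL : ∀ (N : ℕ) [NeZero N], DeligneSerre1974_span_integralLattice1 N 2)
    (hES : eichlerShimuraConstruction)
    (hF : WeierstrassCurve.isIsogenous_iff_frobeniusTrace_eq)
    (hC : ∀ (N : ℕ) [NeZero N], IsNewformOf.level_eq_conductorNorm (N := N)) :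
    CDT_theorem_7_2_2 ↔
      ∀ (W : WeierstrassCurve ℚ) [W.IsElliptic] (ρ : ModPGaloisRep ℚ (ZMod 5) 2),
        W.IsTorsionGaloisRep 5 ρ → ρ.IsAbsIrreducibleOverSqrt 5 → ρ.IsModular →
        W.IsModularGaloisRepTate 5 :=
  CDT_theorem_7_2_2_iff_lift (three_imp_two_of_facts hL hES hF hC)

/-- **The Modularity Theorem (BCDT Theorem A, `exists_isNewformOf`) from the deep printed inputs,
with CDT Theorem 7.2.2 unfolded into its `5`-adic lifting step and (3) ⇒ (2) PROVED from the
catalogued facts**: as `exists_isNewformOf_of_wild_of_auxiliaryCurve_of_CDT721_lift_32_723_of_swan`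
(`CDTTheorem722`) with `h32` discharged by `three_imp_two_of_facts`.  Granted (i) the wild case of
BCDT Thm. 2.2.1, (ii) the Shepherd-Barron–Taylor auxiliary curve, (iii) CDT Thm. 7.2.1, (iv) the
`5`-adic lifting statement for `ρ_{E,5}` (CDT Thm. 7.2.2, proof), (v) Deligne–Serre (2.7.2) in
weight `2`, (vi) the Eichler–Shimura construction, (vii) Faltings' isogeny theorem, (viii) Carayol's
theorem, (ix) the modularity conclusion of CDT Lemma 7.2.3 and (x) Ogg's formula at `ℓ = 5` in its
wild form, every elliptic curve over `ℚ` is modular. [cite: BCDTJAMS2001, Theorem A] -/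
theorem exists_isNewformOf_of_wild_of_auxiliaryCurve_of_CDT721_lift_723_of_swan_of_facts
    (hW : exists_isTorsionGaloisRep_and_isModular_of_not_isTamelyRamifiedAbove)
    (hE : exists_isTorsionGaloisRep_five_and_surjective_three) (h721 : CDT_theorem_7_2_1)
    (hlift : ∀ (W : WeierstrassCurve ℚ) [W.IsElliptic] (ρ : ModPGaloisRep ℚ (ZMod 5) 2),
      W.IsTorsionGaloisRep 5 ρ → ρ.IsAbsIrreducibleOverSqrt 5 → ρ.IsModular →
      W.IsModularGaloisRepTate 5)
    (hL : ∀ (N : ℕ) [NeZero N], DeligneSerre1974_span_integralLattice1 N 2)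
    (hES : eichlerShimuraConstruction)
    (hF : WeierstrassCurve.isIsogenous_iff_frobeniusTrace_eq)
    (hC : ∀ (N : ℕ) [NeZero N], IsNewformOf.level_eq_conductorNorm (N := N))
    (h723 : CDT_lemma_7_2_3_isModular)
    (hSw : ∀ W : WeierstrassCurve ℚ, W.swanConductorAt_rationalTate_eq_wildConductorExponent 5) :
    exists_isNewformOf :=
  exists_isNewformOf_of_wild_of_auxiliaryCurve_of_CDT721_lift_32_723_of_swan hW hE h721 hlift
    (three_imp_two_of_facts hL hES hF hC) h723 hSw

end Literature.NumberTheory.Automorphic.BCDT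

end
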